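import Literature.NumberTheory.Sieve.DrappeauDispersionS2
import Literature.NumberTheory.Sieve.DrappeauDispersionClassCharacterCompletion
import Literature.NumberTheory.Sieve.SmoothCompletionDecay
import Literature.NumberTheory.Sieve.BombieriFriedlanderIwaniecTheorem5Weights
import HarnessLib

/-!
# Drappeau 2017, §5.3 — the Poisson-summation inputs for `𝒮₂`, `𝒮₃` with the weight `BFI.bump`

Topic `Literature/NumberTheory/Sieve`, part of the formalisation of §5 of S. Drappeau, Proc. London
Math. Soc. (3) 114 (2017) 684–732 = arXiv:1504.05549 (Theorem 5.1 = the named fact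
`Literature.NumberTheory.Sieve.Drappeau2017_theorem51`).  Everything here is PROVED; no definition and
no named fact is introduced.

The files `DrappeauDispersionS3` / `DrappeauDispersionS2` reduce `𝒮₃ − α̂(0)X₃` and `𝒮₂ − α̂(0)X₃`
((5.14)–(5.19)) to a bound `E` for the completed `m`-sums, and `DrappeauDispersionCharacterCompletion` /
`DrappeauDispersionClassCharacterCompletion` bound those sums for a general smooth weight
`ψ((k − x₀)/M)` with a truncation point `H ≥ 1`.  This file specialises to the weight actually used in
the proof of Proposition 5.3 — the smooth majorant `α(m) = BFI.bump M (M/2) (m)` of (5.10), i.e.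
`ψ = BFI.bumpC 1 (1/2)` rescaled — and makes the choice `H = ⌈W x^{ε}/M⌉` of the paper
("`W = [q₁,q₂]`, `H = W^{1+ε}/M`"), INCLUDING the case `W x^ε < M` where the paper's `H` is `< 1` and no
dual term is present (`Polymath8a.completion_decay`):

* `Drappeau2017.norm_dispS3_sub_mul_mainX3_le'`, `Drappeau2017.norm_dispS2_sub_mul_mainX3_le'` — the
  reductions of `DrappeauDispersionS3`/`S2` with a bound `E(q₁, q₂)` depending on the pair of moduli;
* `Drappeau2017.bump_one_half_div`, `Drappeau2017.tsum_bumpC_mul_eq_sum_mRange` — the weight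
  `BFI.bump M (M/2)` is `ψ(·/M)`, `ψ = BFI.bump 1 (1/2)`, and `∑_{k ∈ ℤ} ψ(k/M) f(k)` is the finite sum
  over `BFI.mRange M (M/2)`;
* **`Drappeau2017.completion_pair_bump_le`** — for `χⱼ mod qⱼ` of conductor `≤ R`, `Λ ≥ 1`, `n ≥ 2`:
  `|∑_m α(m) χ₁χ̄₂(m) − (A₀/W) ∑_{j<W} χ₁χ̄₂(j)| ≤ 8 Λ τ(W) R + 2^{n+3} K_n W Λ^{1−n}`,
  `A₀ = ∑_m α(m)`, `W = [q₁,q₂]` (the estimate "`O_ε(W^ε R^{1/2})`"-type of §5.3.1 with `Λ = x^ε`);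
* **`Drappeau2017.completion_class_bump_le`** — the analogue for `1_{m N ≡ 1 (q₁)} χ₂(m)`:
  `≤ 8 Λ τ(q₂/(q₁,q₂)) (q₁,q₂) R^{1/2} + 2^{n+3} K_n W Λ^{1−n}` ((5.18)–(5.19)).

## References

* S. Drappeau, Proc. London Math. Soc. (3) 114 (2017) 684–732, arXiv:1504.05549, §5.3.1–5.3.2.
  [cite: Drappeau2017, §5.3 (5.14)–(5.19)]
* D. H. J. Polymath, Algebra & Number Theory 8 (2014), Lemma 4.9. [cite: Polymath8a2014, Lemma 4.9]
-/

noncomputable section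

open Finset Real MeasureTheory
open scoped ArithmeticFunction.sigma ContDiff

namespace Literature.NumberTheory.Sieve

namespace Drappeau2017

/-! ### The reductions with a pair-dependent bound -/

/-- `DrappeauDispersionS3.norm_dispS3_sub_mul_mainX3_le` with a bound `E(q₁, q₂)` depending on the pair
of moduli. [cite: Drappeau2017, §5.3 (5.14)–(5.16)] -/
theorem norm_dispS3_sub_mul_mainX3_le' (R : ℝ) (a₁ a₂ : ℤ) {𝒬 : Finset ℕ} (h𝒬 : ∀ q ∈ 𝒬, 0 < q)
    (ℳ 𝒩 : Finset ℕ) (γ w : ℕ → ℝ) (β : ℕ → ℂ) (A : ℂ) {E : ℕ → ℕ → ℝ}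
    (hE : ∀ q₁ ∈ 𝒬.filter (fun q : ℕ => IsCoprime (q : ℤ) (a₁ * a₂)),
      ∀ q₂ ∈ 𝒬.filter (fun q : ℕ => IsCoprime (q : ℤ) (a₁ * a₂)),
        ∀ χ₁ ∈ (univ.filter fun χ : DirichletCharacter ℂ q₁ => (χ.conductor : ℝ) ≤ R),
          ∀ χ₂ ∈ (univ.filter fun χ : DirichletCharacter ℂ q₂ => (χ.conductor : ℝ) ≤ R),
            ‖∑ m ∈ ℳ, (w m : ℂ) * (χ₁ (m : ZMod q₁) * (χ₂ (m : ZMod q₂))⁻¹) -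
                A / (Nat.lcm q₁ q₂ : ℂ) *
                  ∑ j ∈ Finset.range (Nat.lcm q₁ q₂), χ₁ (j : ZMod q₁) * (χ₂ (j : ZMod q₂))⁻¹‖ ≤
              E q₁ q₂) :
    ‖dispS3 R a₁ a₂ 𝒬 ℳ 𝒩 γ w β - A * mainX3 R a₁ a₂ 𝒬 𝒩 γ β‖ ≤
      ∑ q₁ ∈ 𝒬.filter (fun q : ℕ => IsCoprime (q : ℤ) (a₁ * a₂)),
        ∑ q₂ ∈ 𝒬.filter (fun q : ℕ => IsCoprime (q : ℤ) (a₁ * a₂)), |γ q₁ * γ q₂| *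
          ((((Nat.totient q₁ : ℝ)) * (Nat.totient q₂ : ℝ))⁻¹ *
            (((univ.filter fun χ : DirichletCharacter ℂ q₁ => (χ.conductor : ℝ) ≤ R).card : ℝ) *
              ((univ.filter fun χ : DirichletCharacter ℂ q₂ => (χ.conductor : ℝ) ≤ R).card : ℝ) *
              (∑ n ∈ 𝒩.filter (fun n : ℕ => IsCoprime (n : ℤ) a₂), ‖β n‖) ^ 2 * E q₁ q₂)) := by
  rw [dispS3_sub_mul_mainX3_eq R a₁ a₂ h𝒬]
  refine (norm_sum_le _ _).trans (Finset.sum_le_sum fun q₁ hq₁ => ?_)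
  refine (norm_sum_le _ _).trans (Finset.sum_le_sum fun q₂ hq₂ => ?_)
  set 𝒩' := 𝒩.filter (fun n : ℕ => IsCoprime (n : ℤ) a₂) with h𝒩'
  set 𝒳₁ := (univ.filter fun χ : DirichletCharacter ℂ q₁ => (χ.conductor : ℝ) ≤ R) with h𝒳₁
  set 𝒳₂ := (univ.filter fun χ : DirichletCharacter ℂ q₂ => (χ.conductor : ℝ) ≤ R) with h𝒳₂
  rw [norm_mul, norm_mul, Complex.norm_real, Complex.norm_real, Real.norm_eq_abs,
    Real.norm_eq_abs, ← abs_mul, norm_mul, norm_inv, norm_mul, Complex.norm_natCast,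
    Complex.norm_natCast]
  refine mul_le_mul_of_nonneg_left (mul_le_mul_of_nonneg_left ?_ (by positivity)) (abs_nonneg _)
  have hinner : ∑ n₁ ∈ 𝒩', ∑ n₂ ∈ 𝒩', ‖β n₁‖ * ‖β n₂‖ * E q₁ q₂ =
      (∑ n ∈ 𝒩', ‖β n‖) ^ 2 * E q₁ q₂ := by
    rw [sq, Finset.sum_mul_sum, Finset.sum_mul]
    refine Finset.sum_congr rfl fun n₁ _ => ?_
    rw [Finset.sum_mul]
  calc _ ≤ ∑ χ₁ ∈ 𝒳₁, ∑ χ₂ ∈ 𝒳₂, ∑ n₁ ∈ 𝒩', ∑ n₂ ∈ 𝒩', ‖β n₁‖ * ‖β n₂‖ * E q₁ q₂ := by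
        refine (norm_sum_le _ _).trans (Finset.sum_le_sum fun χ₁ hχ₁ => ?_)
        refine (norm_sum_le _ _).trans (Finset.sum_le_sum fun χ₂ hχ₂ => ?_)
        refine (norm_sum_le _ _).trans (Finset.sum_le_sum fun n₁ _ => ?_)
        refine (norm_sum_le _ _).trans (Finset.sum_le_sum fun n₂ _ => ?_)
        have hEχ := hE q₁ hq₁ q₂ hq₂ χ₁ hχ₁ χ₂ hχ₂
        have hu : ‖χ₁ ((n₁ : ZMod q₁) * ((a₁ : ZMod q₁))⁻¹ * (a₂ : ZMod q₁)) *
            (χ₂ ((n₂ : ZMod q₂) * ((a₁ : ZMod q₂))⁻¹ * (a₂ : ZMod q₂)))⁻¹‖ ≤ 1 := by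
          rw [norm_mul]
          exact mul_le_one₀ (χ₁.norm_le_one _) (norm_nonneg _) (norm_inv_apply_le_one χ₂ _)
        rw [norm_mul, norm_mul, norm_mul, Complex.norm_conj]
        calc ‖β n₁‖ * ‖β n₂‖ * _ * _ ≤ ‖β n₁‖ * ‖β n₂‖ * 1 * E q₁ q₂ :=
              mul_le_mul (mul_le_mul_of_nonneg_left hu (by positivity)) hEχ (norm_nonneg _)
                (by positivity)
          _ = ‖β n₁‖ * ‖β n₂‖ * E q₁ q₂ := by ring
    _ = _ := by
        simp only [hinner, Finset.sum_const, nsmul_eq_mul]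
        ring

/-- `DrappeauDispersionS2.norm_dispS2_sub_mul_mainX3_le` with a bound `E(q₁, q₂)` depending on the pair
of moduli. [cite: Drappeau2017, §5.3 (5.17)–(5.19)] -/
theorem norm_dispS2_sub_mul_mainX3_le' (R : ℝ) (a₁ a₂ : ℤ) {𝒬 : Finset ℕ} (h𝒬 : ∀ q ∈ 𝒬, 0 < q)
    (ℳ 𝒩 : Finset ℕ) (γ w : ℕ → ℝ) (β : ℕ → ℂ) (A : ℂ) {E : ℕ → ℕ → ℝ}
    (hE : ∀ q₁ ∈ 𝒬.filter (fun q : ℕ => IsCoprime (q : ℤ) (a₁ * a₂)),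
      ∀ q₂ ∈ 𝒬.filter (fun q : ℕ => IsCoprime (q : ℤ) (a₁ * a₂)),
        ∀ χ₂ ∈ (univ.filter fun χ : DirichletCharacter ℂ q₂ => (χ.conductor : ℝ) ≤ R),
          ∀ n₁ ∈ 𝒩.filter (fun n : ℕ => IsCoprime (n : ℤ) a₂),
            ‖∑ m ∈ ℳ, (w m : ℂ) *
                  (if (m : ZMod q₁) * ((n₁ : ZMod q₁) * ((a₁ : ZMod q₁))⁻¹ * (a₂ : ZMod q₁)) = 1
                    then χ₂ (m : ZMod q₂) else 0) -
                A / (Nat.lcm q₁ q₂ : ℂ) *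
                  ∑ j ∈ Finset.range (Nat.lcm q₁ q₂),
                    (if (j : ZMod q₁) * ((n₁ : ZMod q₁) * ((a₁ : ZMod q₁))⁻¹ * (a₂ : ZMod q₁)) = 1
                      then χ₂ (j : ZMod q₂) else 0)‖ ≤ E q₁ q₂) :
    ‖dispS2 R a₁ a₂ 𝒬 ℳ 𝒩 γ w β - A * mainX3 R a₁ a₂ 𝒬 𝒩 γ β‖ ≤
      ∑ q₁ ∈ 𝒬.filter (fun q : ℕ => IsCoprime (q : ℤ) (a₁ * a₂)),
        ∑ q₂ ∈ 𝒬.filter (fun q : ℕ => IsCoprime (q : ℤ) (a₁ * a₂)), |γ q₁ * γ q₂| *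
          (((Nat.totient q₂ : ℝ))⁻¹ *
            (((univ.filter fun χ : DirichletCharacter ℂ q₂ => (χ.conductor : ℝ) ≤ R).card : ℝ) *
              (∑ n ∈ 𝒩.filter (fun n : ℕ => IsCoprime (n : ℤ) a₂), ‖β n‖) ^ 2 * E q₁ q₂)) := by
  rw [dispS2_sub_mul_mainX3_eq R a₁ a₂ h𝒬]
  refine (norm_sum_le _ _).trans (Finset.sum_le_sum fun q₁ hq₁ => ?_)
  refine (norm_sum_le _ _).trans (Finset.sum_le_sum fun q₂ hq₂ => ?_)
  set 𝒩' := 𝒩.filter (fun n : ℕ => IsCoprime (n : ℤ) a₂) with h𝒩'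
  set 𝒳₂ := (univ.filter fun χ : DirichletCharacter ℂ q₂ => (χ.conductor : ℝ) ≤ R) with h𝒳₂
  rw [norm_mul, norm_mul, Complex.norm_real, Complex.norm_real, Real.norm_eq_abs,
    Real.norm_eq_abs, ← abs_mul, norm_mul, norm_inv, Complex.norm_natCast]
  refine mul_le_mul_of_nonneg_left (mul_le_mul_of_nonneg_left ?_ (by positivity)) (abs_nonneg _)
  have hinner : ∑ n₁ ∈ 𝒩', ∑ n₂ ∈ 𝒩', ‖β n₁‖ * ‖β n₂‖ * E q₁ q₂ =
      (∑ n ∈ 𝒩', ‖β n‖) ^ 2 * E q₁ q₂ := by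
    rw [sq, Finset.sum_mul_sum, Finset.sum_mul]
    refine Finset.sum_congr rfl fun n₁ _ => ?_
    rw [Finset.sum_mul]
  calc _ ≤ ∑ χ₂ ∈ 𝒳₂, ∑ n₁ ∈ 𝒩', ∑ n₂ ∈ 𝒩', ‖β n₁‖ * ‖β n₂‖ * E q₁ q₂ := by
        refine (norm_sum_le _ _).trans (Finset.sum_le_sum fun χ₂ hχ₂ => ?_)
        refine (norm_sum_le _ _).trans (Finset.sum_le_sum fun n₁ hn₁ => ?_)
        refine (norm_sum_le _ _).trans (Finset.sum_le_sum fun n₂ _ => ?_)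
        have hEχ := hE q₁ hq₁ q₂ hq₂ χ₂ hχ₂ n₁ hn₁
        rw [norm_mul, norm_mul, norm_mul, Complex.norm_conj]
        calc ‖β n₁‖ * ‖β n₂‖ * _ * _ ≤ ‖β n₁‖ * ‖β n₂‖ * 1 * E q₁ q₂ :=
              mul_le_mul (mul_le_mul_of_nonneg_left (χ₂.norm_le_one _) (by positivity)) hEχ
                (norm_nonneg _) (by positivity)
          _ = ‖β n₁‖ * ‖β n₂‖ * E q₁ q₂ := by ring
    _ = _ := by
        simp only [hinner, Finset.sum_const, nsmul_eq_mul]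
        ring

/-! ### The weight `α(m) = BFI.bump M (M/2) (m)` as a rescaled fixed bump -/

/-- Scaling of the plateau weight: `BFI.bump 1 (1/2) (u/M) = BFI.bump M (M/2) u` (`M ≠ 0`). [folklore] -/
theorem bump_one_half_div {M : ℝ} (hM : M ≠ 0) (u : ℝ) :
    BFI.bump 1 (1 / 2) (u / M) = BFI.bump M (M / 2) u := by
  unfold BFI.bump
  have e1 : (1 / 2 : ℝ)⁻¹ * (u / M + (1 / 2 - 1)) = (M / 2)⁻¹ * (u + (M / 2 - M)) := by
    field_simp
  have e2 : -(1 / 2 : ℝ)⁻¹ * (u / M + -(2 * 1 + 1 / 2)) = -(M / 2)⁻¹ * (u + -(2 * M + M / 2)) := by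
    field_simp
  rw [e1, e2]

/-- The `L¹` norms of the fixed bump `ψ = BFI.bumpC 1 (1/2)`: `∫|ψ| ≤ 2`. [folklore] -/
theorem integral_norm_bumpC_one_half_le : ∫ t, ‖BFI.bumpC 1 (1 / 2) t‖ ≤ 2 := by
  have := BFI.integral_norm_bumpC_le (M := 1) (Y := 1 / 2) (by norm_num) zero_le_one
  linarith

/-- `∫|ψ⁽ⁿ⁾| ≤ 2^{n+1} K_n` for `ψ = BFI.bumpC 1 (1/2)`, `n ≥ 1`. [folklore] -/
theorem integral_norm_iteratedDeriv_bumpC_one_half_le {n : ℕ} (hn : 1 ≤ n) :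
    ∫ t, ‖iteratedDeriv n (BFI.bumpC 1 (1 / 2)) t‖ ≤ 2 ^ (n + 1) * BFI.derivConst n := by
  have h := BFI.integral_norm_iteratedDeriv_bumpC_le hn (M := 1) (Y := 1 / 2) (by norm_num) zero_le_one
  refine h.trans (le_of_eq ?_)
  rw [one_div, inv_inv, pow_succ]; ring

/-- **From the series to the finite sum**: for `M > 0` and any `f`,
`∑_{k ∈ ℤ} ψ(k/M) f(k) = ∑_{m ∈ mRange M (M/2)} α(m) f(m)` with `ψ = BFI.bumpC 1 (1/2)`,
`α = BFI.bump M (M/2)` (the weight vanishes at `k ≤ M/2` and `k ≥ 5M/2`). [folklore] -/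
theorem tsum_bumpC_mul_eq_sum_mRange {M : ℝ} (hM : 0 < M) (f : ℤ → ℂ) :
    ∑' k : ℤ, BFI.bumpC 1 (1 / 2) (((k : ℝ) - 0) / M) * f k =
      ∑ m ∈ BFI.mRange M (M / 2), ((BFI.bump M (M / 2) m : ℝ) : ℂ) * f m := by
  have hM2 : (0 : ℝ) < M / 2 := by linarith
  set B : ℕ := ⌊2 * M + M / 2⌋₊ with hB
  have hsupp : ∀ k : ℤ, k ∉ (Finset.range (B + 1)).map Nat.castEmbedding →
      BFI.bumpC 1 (1 / 2) (((k : ℝ) - 0) / M) * f k = 0 := by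
    intro k hk
    rw [sub_zero, BFI.bumpC_apply, bump_one_half_div hM.ne']
    have hk' : k < 0 ∨ (B : ℤ) < k := by
      rcases lt_or_ge k 0 with h | h
      · exact Or.inl h
      · refine Or.inr (lt_of_not_ge fun h' => hk ?_)
        rw [Finset.mem_map]
        refine ⟨k.toNat, Finset.mem_range.2 (by omega), ?_⟩
        simp only [Nat.castEmbedding_apply]; omega
    rcases hk' with hk' | hk'
    · rw [BFI.bump_eq_zero_of_le hM2 hM.le, Complex.ofReal_zero, zero_mul]
      have : (k : ℝ) ≤ 0 := by exact_mod_cast hk'.le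
      linarith
    · rw [BFI.bump_eq_zero_of_ge hM2 hM.le, Complex.ofReal_zero, zero_mul]
      have h1 : (B : ℝ) + 1 ≤ k := by
        have : (B : ℤ) + 1 ≤ k := hk'
        exact_mod_cast this
      have h2 : 2 * M + M / 2 < (B : ℝ) + 1 := Nat.lt_floor_add_one _
      linarith
  rw [tsum_eq_sum (s := (Finset.range (B + 1)).map Nat.castEmbedding) (fun k hk => hsupp k hk),
    Finset.sum_map]
  refine Finset.sum_congr (by rw [BFI.mRange, hB]) fun m _ => ?_
  simp only [Nat.castEmbedding_apply, Int.cast_natCast, sub_zero, BFI.bumpC_apply,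
    bump_one_half_div hM.ne']

/-- The sum of the weight: `∑_{k ∈ ℤ} ψ(k/M) = A₀`, `A₀ = ∑_{m ∈ mRange M (M/2)} α(m)`. [folklore] -/
theorem tsum_bumpC_eq_sum_mRange {M : ℝ} (hM : 0 < M) :
    ∑' k : ℤ, BFI.bumpC 1 (1 / 2) (((k : ℝ) - 0) / M) =
      ((∑ m ∈ BFI.mRange M (M / 2), BFI.bump M (M / 2) m : ℝ) : ℂ) := by
  have h := tsum_bumpC_mul_eq_sum_mRange hM (fun _ => 1)
  simp only [mul_one] at h
  rw [h, Complex.ofReal_sum]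

/-! ### The completed sums for the weight `α` -/

/-- **The Poisson input for `𝒮₃` with the weight `α = BFI.bump M (M/2)`**: for `χⱼ mod qⱼ` (`qⱼ ≥ 1`)
of conductor `≤ R` (`R ≥ 0`), `M > 0`, `Λ ≥ 1` and `n ≥ 2`,
`|∑_m α(m) χ₁(m)χ̄₂(m) − (A₀/W) ∑_{j<W} χ₁(j)χ̄₂(j)| ≤ 8 Λ τ(W) R + 2^{n+3} K_n W / Λ^{n−1}`,
`W = [q₁,q₂]`, `A₀ = ∑_m α(m)`: for `WΛ ≥ M` this is the truncated completion with `H = ⌈WΛ/M⌉` and the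
Gauss-sum bound (`DrappeauDispersionCharacterCompletion`), for `WΛ < M` all non-zero frequencies are in
the tail (`Polymath8a.completion_decay`). [cite: Drappeau2017, §5.3 (5.14)–(5.16)] -/
theorem completion_pair_bump_le {q₁ q₂ : ℕ} (hq₁ : 0 < q₁) (hq₂ : 0 < q₂)
    (χ₁ : DirichletCharacter ℂ q₁) (χ₂ : DirichletCharacter ℂ q₂) {R : ℝ} (hR : 0 ≤ R)
    (hc₁ : (χ₁.conductor : ℝ) ≤ R) (hc₂ : (χ₂.conductor : ℝ) ≤ R) {M : ℝ} (hM : 0 < M) {Λ : ℝ}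
    (hΛ : 1 ≤ Λ) {n : ℕ} (hn : 2 ≤ n) :
    ‖∑ m ∈ BFI.mRange M (M / 2), ((BFI.bump M (M / 2) m : ℝ) : ℂ) *
          (χ₁ (m : ZMod q₁) * (χ₂ (m : ZMod q₂))⁻¹) -
        ((∑ m ∈ BFI.mRange M (M / 2), BFI.bump M (M / 2) m : ℝ) : ℂ) / (Nat.lcm q₁ q₂ : ℂ) *
          ∑ j ∈ Finset.range (Nat.lcm q₁ q₂), χ₁ (j : ZMod q₁) * (χ₂ (j : ZMod q₂))⁻¹‖ ≤
      8 * Λ * (σ 0 (Nat.lcm q₁ q₂) : ℝ) * R +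
        2 ^ (n + 3) * BFI.derivConst n * (Nat.lcm q₁ q₂ : ℝ) / Λ ^ (n - 1) := by
  set W := Nat.lcm q₁ q₂ with hWdef
  have hW : 0 < W := Nat.lcm_pos hq₁ hq₂
  have hWr : (0 : ℝ) < W := by exact_mod_cast hW
  haveI : NeZero (Nat.lcm q₁ q₂) := ⟨hW.ne'⟩
  set ψ : ℝ → ℂ := BFI.bumpC 1 (1 / 2) with hψdef
  have hψ : ContDiff ℝ ∞ ψ := BFI.contDiff_bumpC 1 (1 / 2)
  have hψc : HasCompactSupport ψ := BFI.hasCompactSupport_bumpC (by norm_num) zero_le_one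
  have hI0 : ∫ t, ‖ψ t‖ ≤ 2 := integral_norm_bumpC_one_half_le
  have hIn : ∫ t, ‖iteratedDeriv n ψ t‖ ≤ 2 ^ (n + 1) * BFI.derivConst n :=
    integral_norm_iteratedDeriv_bumpC_one_half_le (by omega)
  have hI0n : 0 ≤ ∫ t, ‖ψ t‖ := integral_nonneg fun _ => norm_nonneg _
  have hInn : 0 ≤ ∫ t, ‖iteratedDeriv n ψ t‖ := integral_nonneg fun _ => norm_nonneg _
  have hK1 := BFI.one_le_derivConst n
  have hΛ0 : 0 < Λ := by linarith
  have hσ1 : (1 : ℝ) ≤ (σ 0 W : ℝ) := by exact_mod_cast one_le_sigma_zero hW.ne'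
  -- the series form of the two sums
  set g : ℤ → ℂ := fun k => χ₁ ((k : ℤ) : ZMod q₁) * (χ₂ ((k : ℤ) : ZMod q₂))⁻¹ with hgdef
  have hlhs : ∑ m ∈ BFI.mRange M (M / 2), ((BFI.bump M (M / 2) m : ℝ) : ℂ) *
        (χ₁ (m : ZMod q₁) * (χ₂ (m : ZMod q₂))⁻¹) = ∑' k : ℤ, ψ (((k : ℝ) - 0) / M) * g k := by
    rw [tsum_bumpC_mul_eq_sum_mRange hM g]
    refine Finset.sum_congr rfl fun m _ => ?_
    simp only [hgdef, Int.cast_natCast]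
  have hA : ((∑ m ∈ BFI.mRange M (M / 2), BFI.bump M (M / 2) m : ℝ) : ℂ) =
      ∑' k : ℤ, ψ (((k : ℝ) - 0) / M) := (tsum_bumpC_eq_sum_mRange hM).symm
  have hrange : ∑ j ∈ Finset.range W, χ₁ (j : ZMod q₁) * (χ₂ (j : ZMod q₂))⁻¹ =
      ∑ j ∈ Finset.range W, g j := by
    refine Finset.sum_congr rfl fun j _ => ?_
    simp only [hgdef, Int.cast_natCast]
  have hg1 : ∀ k : ℤ, ‖g k‖ ≤ 1 := fun k => by
    simp only [hgdef, norm_mul]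
    exact mul_le_one₀ (χ₁.norm_le_one _) (norm_nonneg _) (norm_inv_apply_le_one χ₂ _)
  rw [hlhs, hA, hrange]
  -- positivity of the two halves of the bound
  have hT₁0 : 0 ≤ 8 * Λ * (σ 0 W : ℝ) * R := by positivity
  have hT₂0 : 0 ≤ 2 ^ (n + 3) * BFI.derivConst n * (W : ℝ) / Λ ^ (n - 1) := by positivity
  have h2π : (1 : ℝ) ≤ 2 * π := by linarith [Real.pi_gt_three]
  have hWM : ((W : ℝ) / (2 * π * M)) ^ n ≤ ((W : ℝ) / M) ^ n := by
    refine pow_le_pow_left₀ (by positivity) ?_ n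
    refine div_le_div_of_nonneg_left hWr.le hM ?_
    have : 1 * M ≤ 2 * π * M := mul_le_mul_of_nonneg_right h2π hM.le
    linarith
  by_cases hcase : M ≤ (W : ℝ) * Λ
  · -- `WΛ ≥ M`: truncated completion with `H = ⌈WΛ/M⌉`
    set H : ℕ := ⌈(W : ℝ) * Λ / M⌉₊ with hHdef
    have hq1 : 1 ≤ (W : ℝ) * Λ / M := by rw [le_div_iff₀ hM]; linarith
    have hH1 : 1 ≤ H := Nat.one_le_ceil_iff.2 (by linarith)
    have hHr : (H : ℝ) ≤ 2 * ((W : ℝ) * Λ / M) := by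
      have := Nat.ceil_lt_add_one (show 0 ≤ (W : ℝ) * Λ / M by positivity)
      rw [← hHdef] at this; linarith
    have hHlo : (W : ℝ) * Λ / M ≤ H := Nat.le_ceil _
    have hH0 : (0 : ℝ) < H := by exact_mod_cast hH1
    have h := norm_tsum_smooth_mul_char_pair_sub_le χ₁ χ₂ hψ hψc hM 0 hH1 hn
    refine h.trans (add_le_add ?_ ?_)
    · -- main dual terms
      have hsq : Real.sqrt (χ₁.conductor * χ₂.conductor) ≤ R := by
        calc Real.sqrt (χ₁.conductor * χ₂.conductor) ≤ Real.sqrt (R * R) :=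
              Real.sqrt_le_sqrt (mul_le_mul hc₁ hc₂ (Nat.cast_nonneg _) hR)
          _ = R := Real.sqrt_mul_self hR
      calc M / W * (∫ t, ‖ψ t‖) * (2 * H * (σ 0 W : ℝ) * Real.sqrt (χ₁.conductor * χ₂.conductor))
          ≤ M / W * 2 * (2 * (2 * ((W : ℝ) * Λ / M)) * (σ 0 W : ℝ) * R) := by
            have : M / ↑W * (∫ t, ‖ψ t‖) ≤ M / W * 2 := mul_le_mul_of_nonneg_left hI0 (by positivity)
            refine mul_le_mul this ?_ (by positivity) (by positivity)
            gcongr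
        _ = 8 * Λ * (σ 0 W : ℝ) * R := by field_simp; ring
    · -- the tail
      have hHpow : ((H : ℝ) ^ (n - 1))⁻¹ ≤ (M / ((W : ℝ) * Λ)) ^ (n - 1) := by
        rw [← inv_pow, show M / ((W : ℝ) * Λ) = ((W : ℝ) * Λ / M)⁻¹ by rw [inv_div]]
        exact pow_le_pow_left₀ (by positivity) ((inv_le_inv₀ hH0 (by positivity)).2 hHlo) _
      calc (W : ℝ) * (2 * (∫ t, ‖iteratedDeriv n ψ t‖) * ((W : ℝ) / (2 * π * M)) ^ n * (M / W) *
            ((H : ℝ) ^ (n - 1))⁻¹)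
          ≤ (W : ℝ) * (2 * (2 ^ (n + 1) * BFI.derivConst n) * ((W : ℝ) / M) ^ n * (M / W) *
              (M / ((W : ℝ) * Λ)) ^ (n - 1)) := by
            gcongr
        _ = 2 ^ (n + 2) * BFI.derivConst n * (W : ℝ) / Λ ^ (n - 1) := by
            obtain ⟨k, rfl⟩ : ∃ k, n = k + 1 := ⟨n - 1, by omega⟩
            simp only [Nat.add_sub_cancel, pow_succ, div_pow, mul_pow]
            field_simp
        _ ≤ 2 ^ (n + 3) * BFI.derivConst n * (W : ℝ) / Λ ^ (n - 1) := by
            refine div_le_div_of_nonneg_right ?_ (by positivity)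
            refine mul_le_mul_of_nonneg_right (mul_le_mul_of_nonneg_right ?_ (by linarith))
              (by positivity)
            exact pow_le_pow_right₀ (by norm_num) (by omega)
  · -- `WΛ < M`: no dual terms
    have hcase' : (W : ℝ) * Λ < M := lt_of_not_ge hcase
    have hper : ∀ m k : ℤ, g (m + W * k) = g m := by
      intro m k
      simp only [hgdef]
      have h1 : ((m + W * k : ℤ) : ZMod q₁) = (m : ZMod q₁) := by
        push_cast
        rw [show ((W : ℕ) : ZMod q₁) = 0 from (ZMod.natCast_eq_zero_iff W q₁).2 (Nat.dvd_lcm_left _ _)]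
        ring
      have h2 : ((m + W * k : ℤ) : ZMod q₂) = (m : ZMod q₂) := by
        push_cast
        rw [show ((W : ℕ) : ZMod q₂) = 0 from (ZMod.natCast_eq_zero_iff W q₂).2 (Nat.dvd_lcm_right _ _)]
        ring
      rw [h1, h2]
    have h := Polymath8a.completion_decay hψ hψc hM 0 Nat.one_pos hW 0 hper hn
    simp only [Nat.cast_one, Int.cast_zero, zero_add, one_mul] at h
    refine h.trans ?_
    have hG : ∑ j ∈ Finset.range W, ‖g j‖ ≤ W := by
      calc ∑ j ∈ Finset.range W, ‖g j‖ ≤ ∑ j ∈ Finset.range W, (1 : ℝ) :=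
            Finset.sum_le_sum fun j _ => hg1 j
        _ = W := by simp
    have hWMΛ : (W : ℝ) / M ≤ Λ⁻¹ := by
      rw [div_le_iff₀ hM, inv_mul_eq_div, le_div_iff₀ hΛ0]
      exact hcase'.le
    calc (∑ j ∈ Finset.range W, ‖g j‖) * (4 * (∫ t, ‖iteratedDeriv n ψ t‖) *
          ((W : ℝ) / (2 * π * M)) ^ n * (M / W))
        ≤ (W : ℝ) * (4 * (2 ^ (n + 1) * BFI.derivConst n) * ((W : ℝ) / M) ^ n * (M / W)) := by
          gcongr
      _ = 2 ^ (n + 3) * BFI.derivConst n * (W : ℝ) * ((W : ℝ) / M) ^ (n - 1) := by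
          obtain ⟨k, rfl⟩ : ∃ k, n = k + 1 := ⟨n - 1, by omega⟩
          simp only [Nat.add_sub_cancel, pow_succ]
          field_simp
          ring
      _ ≤ 2 ^ (n + 3) * BFI.derivConst n * (W : ℝ) * (Λ⁻¹) ^ (n - 1) := by
          gcongr
      _ = 2 ^ (n + 3) * BFI.derivConst n * (W : ℝ) / Λ ^ (n - 1) := by
          rw [inv_pow]; ring
      _ ≤ 8 * Λ * (σ 0 W : ℝ) * R + 2 ^ (n + 3) * BFI.derivConst n * (W : ℝ) / Λ ^ (n - 1) := by
          linarith

/-- **The Poisson input for `𝒮₂` with the weight `α = BFI.bump M (M/2)`** ((5.18)–(5.19)): for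
`N ∈ ℤ/q₁`, `χ mod q₂` of conductor `≤ R` (so `R ≥ 0`), `M > 0`, `Λ ≥ 1`, `n ≥ 2`,
`|∑_m α(m) 1_{mN ≡ 1 (q₁)} χ(m) − (A₀/W) ∑_{j<W} 1_{jN ≡ 1 (q₁)} χ(j)| ≤ 8 Λ τ(q₂/(q₁,q₂)) (q₁,q₂) R^{1/2} + 2^{n+3} K_n W/Λ^{n−1}`
(`W = [q₁,q₂]`; truncated completion with `H = ⌈WΛ/M⌉` and `DrappeauDispersionClassCharacterCompletion`
when `WΛ ≥ M`, `Polymath8a.completion_decay` otherwise). [cite: Drappeau2017, §5.3 (5.17)–(5.19)] -/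
theorem completion_class_bump_le {q₁ q₂ : ℕ} (hq₁ : 0 < q₁) (hq₂ : 0 < q₂) (N : ZMod q₁)
    (χ : DirichletCharacter ℂ q₂) {R : ℝ} (hc : (χ.conductor : ℝ) ≤ R) {M : ℝ}
    (hM : 0 < M) {Λ : ℝ} (hΛ : 1 ≤ Λ) {n : ℕ} (hn : 2 ≤ n) :
    ‖∑ m ∈ BFI.mRange M (M / 2), ((BFI.bump M (M / 2) m : ℝ) : ℂ) *
          (if (m : ZMod q₁) * N = 1 then χ (m : ZMod q₂) else 0) -
        ((∑ m ∈ BFI.mRange M (M / 2), BFI.bump M (M / 2) m : ℝ) : ℂ) / (Nat.lcm q₁ q₂ : ℂ) *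
          ∑ j ∈ Finset.range (Nat.lcm q₁ q₂), (if (j : ZMod q₁) * N = 1 then χ (j : ZMod q₂) else 0)‖ ≤
      8 * Λ * (σ 0 (q₂ / Nat.gcd q₁ q₂) : ℝ) * (Nat.gcd q₁ q₂) * Real.sqrt R +
        2 ^ (n + 3) * BFI.derivConst n * (Nat.lcm q₁ q₂ : ℝ) / Λ ^ (n - 1) := by
  set W := Nat.lcm q₁ q₂ with hWdef
  have hW : 0 < W := Nat.lcm_pos hq₁ hq₂
  have hWr : (0 : ℝ) < W := by exact_mod_cast hW
  haveI : NeZero q₁ := ⟨hq₁.ne'⟩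
  haveI : NeZero q₂ := ⟨hq₂.ne'⟩
  set ψ : ℝ → ℂ := BFI.bumpC 1 (1 / 2) with hψdef
  have hψ : ContDiff ℝ ∞ ψ := BFI.contDiff_bumpC 1 (1 / 2)
  have hψc : HasCompactSupport ψ := BFI.hasCompactSupport_bumpC (by norm_num) zero_le_one
  have hI0 : ∫ t, ‖ψ t‖ ≤ 2 := integral_norm_bumpC_one_half_le
  have hIn : ∫ t, ‖iteratedDeriv n ψ t‖ ≤ 2 ^ (n + 1) * BFI.derivConst n :=
    integral_norm_iteratedDeriv_bumpC_one_half_le (by omega)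
  have hI0n : 0 ≤ ∫ t, ‖ψ t‖ := integral_nonneg fun _ => norm_nonneg _
  have hInn : 0 ≤ ∫ t, ‖iteratedDeriv n ψ t‖ := integral_nonneg fun _ => norm_nonneg _
  have hK1 := BFI.one_le_derivConst n
  have hΛ0 : 0 < Λ := by linarith
  -- the series form of the two sums
  set g : ℤ → ℂ := fun k => if ((k : ℤ) : ZMod q₁) * N = 1 then χ ((k : ℤ) : ZMod q₂) else 0
    with hgdef
  have hlhs : ∑ m ∈ BFI.mRange M (M / 2), ((BFI.bump M (M / 2) m : ℝ) : ℂ) *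
        (if (m : ZMod q₁) * N = 1 then χ (m : ZMod q₂) else 0) =
      ∑' k : ℤ, ψ (((k : ℝ) - 0) / M) * g k := by
    rw [tsum_bumpC_mul_eq_sum_mRange hM g]
    refine Finset.sum_congr rfl fun m _ => ?_
    simp only [hgdef, Int.cast_natCast]
  have hA : ((∑ m ∈ BFI.mRange M (M / 2), BFI.bump M (M / 2) m : ℝ) : ℂ) =
      ∑' k : ℤ, ψ (((k : ℝ) - 0) / M) := (tsum_bumpC_eq_sum_mRange hM).symm
  have hrange : ∑ j ∈ Finset.range W, (if (j : ZMod q₁) * N = 1 then χ (j : ZMod q₂) else 0) =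
      ∑ j ∈ Finset.range W, g j := by
    refine Finset.sum_congr rfl fun j _ => ?_
    simp only [hgdef, Int.cast_natCast]
  have hg1 : ∀ k : ℤ, ‖g k‖ ≤ 1 := fun k => by
    simp only [hgdef]
    split_ifs
    · exact χ.norm_le_one _
    · simp
  rw [hlhs, hA, hrange]
  have hT₁0 : 0 ≤ 8 * Λ * (σ 0 (q₂ / Nat.gcd q₁ q₂) : ℝ) * (Nat.gcd q₁ q₂) * Real.sqrt R := by
    positivity
  have h2π : (1 : ℝ) ≤ 2 * π := by linarith [Real.pi_gt_three]
  have hWM : ((W : ℝ) / (2 * π * M)) ^ n ≤ ((W : ℝ) / M) ^ n := by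
    refine pow_le_pow_left₀ (by positivity) ?_ n
    refine div_le_div_of_nonneg_left hWr.le hM ?_
    have : 1 * M ≤ 2 * π * M := mul_le_mul_of_nonneg_right h2π hM.le
    linarith
  by_cases hcase : M ≤ (W : ℝ) * Λ
  · -- `WΛ ≥ M`: truncated completion with `H = ⌈WΛ/M⌉`
    set H : ℕ := ⌈(W : ℝ) * Λ / M⌉₊ with hHdef
    have hq1 : 1 ≤ (W : ℝ) * Λ / M := by rw [le_div_iff₀ hM]; linarith
    have hH1 : 1 ≤ H := Nat.one_le_ceil_iff.2 (by linarith)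
    have hHr : (H : ℝ) ≤ 2 * ((W : ℝ) * Λ / M) := by
      have := Nat.ceil_lt_add_one (show 0 ≤ (W : ℝ) * Λ / M by positivity)
      rw [← hHdef] at this; linarith
    have hHlo : (W : ℝ) * Λ / M ≤ H := Nat.le_ceil _
    have hH0 : (0 : ℝ) < H := by exact_mod_cast hH1
    have h := norm_tsum_smooth_mul_class_char_sub_le N χ hψ hψc hM 0 hH1 hn
    refine h.trans (add_le_add ?_ ?_)
    · have hsq : Real.sqrt χ.conductor ≤ Real.sqrt R := Real.sqrt_le_sqrt hc
      calc M / (Nat.lcm q₁ q₂) * (∫ t, ‖ψ t‖) *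
            (2 * H * (σ 0 (q₂ / Nat.gcd q₁ q₂) : ℝ) * (Nat.gcd q₁ q₂) * Real.sqrt χ.conductor)
          ≤ M / W * 2 * (2 * (2 * ((W : ℝ) * Λ / M)) * (σ 0 (q₂ / Nat.gcd q₁ q₂) : ℝ) *
              (Nat.gcd q₁ q₂) * Real.sqrt R) := by
            have : M / ↑W * (∫ t, ‖ψ t‖) ≤ M / W * 2 := mul_le_mul_of_nonneg_left hI0 (by positivity)
            refine mul_le_mul this ?_ (by positivity) (by positivity)
            gcongr
        _ = 8 * Λ * (σ 0 (q₂ / Nat.gcd q₁ q₂) : ℝ) * (Nat.gcd q₁ q₂) * Real.sqrt R := by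
            field_simp; ring
    · have hHpow : ((H : ℝ) ^ (n - 1))⁻¹ ≤ (M / ((W : ℝ) * Λ)) ^ (n - 1) := by
        rw [← inv_pow, show M / ((W : ℝ) * Λ) = ((W : ℝ) * Λ / M)⁻¹ by rw [inv_div]]
        exact pow_le_pow_left₀ (by positivity) ((inv_le_inv₀ hH0 (by positivity)).2 hHlo) _
      calc (Nat.lcm q₁ q₂ : ℝ) * (2 * (∫ t, ‖iteratedDeriv n ψ t‖) *
            ((Nat.lcm q₁ q₂ : ℝ) / (2 * π * M)) ^ n * (M / (Nat.lcm q₁ q₂)) * ((H : ℝ) ^ (n - 1))⁻¹)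
          ≤ (W : ℝ) * (2 * (2 ^ (n + 1) * BFI.derivConst n) * ((W : ℝ) / M) ^ n * (M / W) *
              (M / ((W : ℝ) * Λ)) ^ (n - 1)) := by
            gcongr
        _ = 2 ^ (n + 2) * BFI.derivConst n * (W : ℝ) / Λ ^ (n - 1) := by
            obtain ⟨k, rfl⟩ : ∃ k, n = k + 1 := ⟨n - 1, by omega⟩
            simp only [Nat.add_sub_cancel, pow_succ, div_pow, mul_pow]
            field_simp
        _ ≤ 2 ^ (n + 3) * BFI.derivConst n * (W : ℝ) / Λ ^ (n - 1) := by
            refine div_le_div_of_nonneg_right ?_ (by positivity)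
            refine mul_le_mul_of_nonneg_right (mul_le_mul_of_nonneg_right ?_ (by linarith))
              (by positivity)
            exact pow_le_pow_right₀ (by norm_num) (by omega)
  · -- `WΛ < M`: no dual terms
    have hcase' : (W : ℝ) * Λ < M := lt_of_not_ge hcase
    have hper : ∀ m k : ℤ, g (m + W * k) = g m := by
      intro m k
      simp only [hgdef]
      have h1 : ((m + W * k : ℤ) : ZMod q₁) = (m : ZMod q₁) := by
        push_cast
        rw [show ((W : ℕ) : ZMod q₁) = 0 from (ZMod.natCast_eq_zero_iff W q₁).2 (Nat.dvd_lcm_left _ _)]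
        ring
      have h2 : ((m + W * k : ℤ) : ZMod q₂) = (m : ZMod q₂) := by
        push_cast
        rw [show ((W : ℕ) : ZMod q₂) = 0 from (ZMod.natCast_eq_zero_iff W q₂).2 (Nat.dvd_lcm_right _ _)]
        ring
      rw [h1, h2]
    have h := Polymath8a.completion_decay hψ hψc hM 0 Nat.one_pos hW 0 hper hn
    simp only [Nat.cast_one, Int.cast_zero, zero_add, one_mul] at h
    refine h.trans ?_
    have hG : ∑ j ∈ Finset.range W, ‖g j‖ ≤ W := by
      calc ∑ j ∈ Finset.range W, ‖g j‖ ≤ ∑ j ∈ Finset.range W, (1 : ℝ) :=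
            Finset.sum_le_sum fun j _ => hg1 j
        _ = W := by simp
    have hWMΛ : (W : ℝ) / M ≤ Λ⁻¹ := by
      rw [div_le_iff₀ hM, inv_mul_eq_div, le_div_iff₀ hΛ0]
      exact hcase'.le
    calc (∑ j ∈ Finset.range W, ‖g j‖) * (4 * (∫ t, ‖iteratedDeriv n ψ t‖) *
          ((W : ℝ) / (2 * π * M)) ^ n * (M / W))
        ≤ (W : ℝ) * (4 * (2 ^ (n + 1) * BFI.derivConst n) * ((W : ℝ) / M) ^ n * (M / W)) := by
          gcongr
      _ = 2 ^ (n + 3) * BFI.derivConst n * (W : ℝ) * ((W : ℝ) / M) ^ (n - 1) := by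
          obtain ⟨k, rfl⟩ : ∃ k, n = k + 1 := ⟨n - 1, by omega⟩
          simp only [Nat.add_sub_cancel, pow_succ]
          field_simp
          ring
      _ ≤ 2 ^ (n + 3) * BFI.derivConst n * (W : ℝ) * (Λ⁻¹) ^ (n - 1) := by
          gcongr
      _ = 2 ^ (n + 3) * BFI.derivConst n * (W : ℝ) / Λ ^ (n - 1) := by
          rw [inv_pow]; ring
      _ ≤ 8 * Λ * (σ 0 (q₂ / Nat.gcd q₁ q₂) : ℝ) * (Nat.gcd q₁ q₂) * Real.sqrt R +
            2 ^ (n + 3) * BFI.derivConst n * (W : ℝ) / Λ ^ (n - 1) := by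
          linarith

end Drappeau2017

end Literature.NumberTheory.Sieve

end
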